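import Summits.Ventures.PercRepro.C041TreeStates

/-!
# ROW C-041 — the invalid count of a tree zone, the DICTIONARY and THEOREM (trees) on the state space
(mine-3, gen 57; C-041.md §15 (c), (d), (i), §19)

Continues C041TreeStates: the recursion of C-041.md §15 (c) for the invalid count `I` in its four cases
(`TZ.cI_node_both` — marks of both types: `I = 0`; `TZ.cI_node_one` — 1-marks only: `I = ∏ (I_j + A_j)`;
`TZ.cI_node_two` — 2-marks only: `I = ∏ (I_j + B_j)`; `TZ.cI_node_zero` — no marks, by inclusion–exclusion:
`I + ∏ (I_j + F_j) = ∏ (I_j + B_j) + ∏ (I_j + A_j)`), then **`TZ.counts_eq`** — THE DICTIONARY: the four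
cardinalities of the state space are the four functions of the recursion `TZ.counts` of C041TreeZone — and its
consequences through `tz_K4`: **`K4_counts`**, **`cs_counts`** (`(F − I)² ≤ T₁·T₂`, CONJECTURE (CS) on every tree
zone with one anchor) and **`zoneOCube_counts`** (`2F ≤ T₁ + T₂ + 2I`, the ZONE O-CUBE on every tree zone with one
anchor) — THEOREM (trees) of C-041.md §15 (d) as a kernel theorem about the combinatorial state space.
-/

namespace PercRepro

namespace TreeClosure

open Finset

/-- The number of all-blue colourings of `n` marks is one. -/
theorem card_allBlue (n : ℕ) : (univ.filter fun m : Fin n → Bool => ∀ i, m i = false).card = 1 := by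
  rw [Finset.card_eq_one]
  exact ⟨fun _ => false, by ext m; simp [funext_iff]⟩

/-- A root with marks of both types has no invalid admissible state. -/
theorem TZ.cI_node_both (p q d : ℕ) (cs : Fin d → TZ) (hp : 1 ≤ p) (hq : 1 ≤ q) :
    (TZ.node p q d cs).cI = 0 := by
  unfold TZ.cI
  rw [Finset.card_eq_zero, Finset.filter_eq_empty_iff]
  rintro s - ⟨⟨-, hnot⟩, hK⟩
  simp only [TZ.rb1, TZ.rb2, TZ.redK, not_or, not_exists, not_and, Bool.not_eq_true] at hnot hK
  exact (hnot (Or.inl ⟨⟨0, hp⟩, hK.1 _⟩)).1 ⟨0, hq⟩ (hK.2.1 _)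

/-- The invalid admissible states of a root with 1-marks only. -/
theorem TZ.predI1_node (p q d : ℕ) (cs : Fin d → TZ) (hp : 1 ≤ p) (hq : q = 0)
    (s : (TZ.node p q d cs).St) :
    ((TZ.node p q d cs).adm s ∧ ¬ (TZ.node p q d cs).redK s)
      ↔ ((∀ i, s.1 i = false) ∧ (∀ i, s.2.1 i = false) ∧
          ∀ j, ((s.2.2 j).1 = true → (cs j).adm (s.2.2 j).2 ∧ ¬ (cs j).redK (s.2.2 j).2) ∧
            ((s.2.2 j).1 = false → (cs j).adm (s.2.2 j).2 ∧ ¬ (cs j).rb2 (s.2.2 j).2)) := by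
  simp only [TZ.adm, TZ.rb1, TZ.rb2, TZ.admR, TZ.redK, not_or, not_exists, not_and, Bool.not_eq_false,
    Bool.not_eq_true]
  constructor
  · rintro ⟨⟨hadm, hnot⟩, h1, h2, hK⟩
    have hn2 := hnot (Or.inl ⟨⟨0, hp⟩, h1 _⟩)
    refine ⟨h1, h2, fun j => ⟨fun he => ⟨(hadm j).1 he, hK j he⟩, fun he => ?_⟩⟩
    exact ⟨⟨(hadm j).2 he, fun _ hb => hn2.2 j he hb⟩, hn2.2 j he⟩
  · rintro ⟨h1, h2, h⟩
    refine ⟨⟨fun j => ⟨fun he => ((h j).1 he).1, fun he => ((h j).2 he).1.1⟩, fun _ => ?_⟩, h1, h2,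
      fun j he => ((h j).1 he).2⟩
    exact ⟨fun i => absurd i.isLt (by omega), fun j he => ((h j).2 he).2⟩

/-- The invalid admissible states of a root with 2-marks only. -/
theorem TZ.predI2_node (p q d : ℕ) (cs : Fin d → TZ) (hp : p = 0) (hq : 1 ≤ q)
    (s : (TZ.node p q d cs).St) :
    ((TZ.node p q d cs).adm s ∧ ¬ (TZ.node p q d cs).redK s)
      ↔ ((∀ i, s.1 i = false) ∧ (∀ i, s.2.1 i = false) ∧
          ∀ j, ((s.2.2 j).1 = true → (cs j).adm (s.2.2 j).2 ∧ ¬ (cs j).redK (s.2.2 j).2) ∧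
            ((s.2.2 j).1 = false → (cs j).adm (s.2.2 j).2 ∧ ¬ (cs j).rb1 (s.2.2 j).2)) := by
  simp only [TZ.adm, TZ.rb1, TZ.rb2, TZ.admR, TZ.redK, not_or, not_exists, not_and, Bool.not_eq_false,
    Bool.not_eq_true]
  constructor
  · rintro ⟨⟨hadm, hnot⟩, h1, h2, hK⟩
    have hn1 : ¬ ((∃ i, s.1 i = false) ∨ ∃ j, (s.2.2 j).1 = false ∧ (cs j).rb1 (s.2.2 j).2) :=
      fun ha => absurd ((hnot ha).1 ⟨0, hq⟩) (by simp [h2])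
    simp only [not_or, not_exists, not_and] at hn1
    refine ⟨h1, h2, fun j => ⟨fun he => ⟨(hadm j).1 he, hK j he⟩, fun he => ?_⟩⟩
    exact ⟨⟨(hadm j).2 he, fun ha _ => hn1.2 j he ha⟩, hn1.2 j he⟩
  · rintro ⟨h1, h2, h⟩
    refine ⟨⟨fun j => ⟨fun he => ((h j).1 he).1, fun he => ((h j).2 he).1.1⟩, fun ha => ?_⟩, h1, h2,
      fun j he => ((h j).1 he).2⟩
    rcases ha with ⟨i, -⟩ | ⟨j, hje, hj⟩
    · exact absurd i.isLt (by omega)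
    · exact (((h j).2 hje).2 hj).elim

/-- **The recursion for `I`, root with 1-marks only**: `I = ∏ (I_j + A_j)`. -/
theorem TZ.cI_node_one (p q d : ℕ) (cs : Fin d → TZ) (hp : 1 ≤ p) (hq : q = 0) :
    (TZ.node p q d cs).cI = ∏ j, ((cs j).cI + (cs j).cA) := by
  unfold TZ.cI
  rw [Finset.filter_congr (fun s _ => TZ.predI1_node p q d cs hp hq s)]
  rw [card_filter_node p q d cs (fun m => ∀ i, m i = false) (fun m => ∀ i, m i = false)
    (fun j x => (x.1 = true → (cs j).adm x.2 ∧ ¬ (cs j).redK x.2) ∧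
      (x.1 = false → (cs j).adm x.2 ∧ ¬ (cs j).rb2 x.2))]
  rw [card_allBlue, card_allBlue, one_mul, one_mul]
  refine Finset.prod_congr rfl (fun j _ => ?_)
  unfold TZ.cA
  exact card_filter_bool (fun x => (cs j).adm x ∧ ¬ (cs j).redK x) (fun x => (cs j).adm x ∧ ¬ (cs j).rb2 x)

/-- **The recursion for `I`, root with 2-marks only**: `I = ∏ (I_j + B_j)`. -/
theorem TZ.cI_node_two (p q d : ℕ) (cs : Fin d → TZ) (hp : p = 0) (hq : 1 ≤ q) :
    (TZ.node p q d cs).cI = ∏ j, ((cs j).cI + (cs j).cB) := by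
  unfold TZ.cI
  rw [Finset.filter_congr (fun s _ => TZ.predI2_node p q d cs hp hq s)]
  rw [card_filter_node p q d cs (fun m => ∀ i, m i = false) (fun m => ∀ i, m i = false)
    (fun j x => (x.1 = true → (cs j).adm x.2 ∧ ¬ (cs j).redK x.2) ∧
      (x.1 = false → (cs j).adm x.2 ∧ ¬ (cs j).rb1 x.2))]
  rw [card_allBlue, card_allBlue, one_mul, one_mul]
  refine Finset.prod_congr rfl (fun j _ => ?_)
  unfold TZ.cB
  exact card_filter_bool (fun x => (cs j).adm x ∧ ¬ (cs j).redK x) (fun x => (cs j).adm x ∧ ¬ (cs j).rb1 x)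

/-- The common part of the invalid-state predicate of an unmarked root: all marks blue, red children admissible
and invalid, merged children admissible beyond their root sub-zone. -/
def TZ.Y0 (p q d : ℕ) (cs : Fin d → TZ) (s : (TZ.node p q d cs).St) : Prop :=
  (∀ i, s.1 i = false) ∧ (∀ i, s.2.1 i = false) ∧
    ∀ j, ((s.2.2 j).1 = true → (cs j).adm (s.2.2 j).2 ∧ ¬ (cs j).redK (s.2.2 j).2) ∧
      ((s.2.2 j).1 = false → (cs j).admR (s.2.2 j).2)

/-- Some merged child carries a blue 1-mark in its root sub-zone. -/
def TZ.R1 (p q d : ℕ) (cs : Fin d → TZ) (s : (TZ.node p q d cs).St) : Prop :=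
  ∃ j, (s.2.2 j).1 = false ∧ (cs j).rb1 (s.2.2 j).2

/-- Some merged child carries a blue 2-mark in its root sub-zone. -/
def TZ.R2 (p q d : ℕ) (cs : Fin d → TZ) (s : (TZ.node p q d cs).St) : Prop :=
  ∃ j, (s.2.2 j).1 = false ∧ (cs j).rb2 (s.2.2 j).2

/-- Decidability of `Y0`. -/
instance (p q d : ℕ) (cs : Fin d → TZ) : DecidablePred (TZ.Y0 p q d cs) := fun s => by
  unfold TZ.Y0; infer_instance
/-- Decidability of `R1`. -/
instance (p q d : ℕ) (cs : Fin d → TZ) : DecidablePred (TZ.R1 p q d cs) := fun s => by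
  unfold TZ.R1; infer_instance
/-- Decidability of `R2`. -/
instance (p q d : ℕ) (cs : Fin d → TZ) : DecidablePred (TZ.R2 p q d cs) := fun s => by
  unfold TZ.R2; infer_instance

/-- The invalid admissible states of an unmarked root. -/
theorem TZ.predI0_node (p q d : ℕ) (cs : Fin d → TZ) (hp : p = 0) (hq : q = 0)
    (s : (TZ.node p q d cs).St) :
    ((TZ.node p q d cs).adm s ∧ ¬ (TZ.node p q d cs).redK s)
      ↔ (TZ.Y0 p q d cs s ∧ ¬ (TZ.R1 p q d cs s ∧ TZ.R2 p q d cs s)) := by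
  simp only [TZ.adm, TZ.rb1, TZ.rb2, TZ.admR, TZ.redK, TZ.Y0, TZ.R1, TZ.R2, not_or, not_exists, not_and,
    Bool.not_eq_false, Bool.not_eq_true]
  constructor
  · rintro ⟨⟨hadm, hnot⟩, h1, h2, hK⟩
    refine ⟨⟨h1, h2, fun j => ⟨fun he => ⟨(hadm j).1 he, hK j he⟩, fun he => (hadm j).2 he⟩⟩, ?_⟩
    intro hR1 j' hje' hj'
    exact (hnot (Or.inr hR1)).2 j' hje' hj'
  · rintro ⟨⟨h1, h2, h⟩, hnot⟩
    refine ⟨⟨fun j => ⟨fun he => ((h j).1 he).1, fun he => (h j).2 he⟩, fun ha => ?_⟩, h1, h2,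
      fun j he => ((h j).1 he).2⟩
    rcases ha with ⟨i, -⟩ | ⟨j, hje, hj⟩
    · exact absurd i.isLt (by omega)
    · exact ⟨fun i => absurd i.isLt (by omega), fun j' hje' hj' => hnot ⟨j, hje, hj⟩ j' hje' hj'⟩

/-- `admR ∧ ¬rb1 = adm ∧ ¬rb1` on a child. -/
theorem TZ.admR_not_rb1 (t : TZ) (x : t.St) : (t.admR x ∧ ¬ t.rb1 x) ↔ (t.adm x ∧ ¬ t.rb1 x) := by
  unfold TZ.adm; tauto

/-- `admR ∧ ¬rb2 = adm ∧ ¬rb2` on a child. -/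
theorem TZ.admR_not_rb2 (t : TZ) (x : t.St) : (t.admR x ∧ ¬ t.rb2 x) ↔ (t.adm x ∧ ¬ t.rb2 x) := by
  unfold TZ.adm; tauto

/-- The states with no merged child of type 1: `∏ (I_j + B_j)`. -/
theorem TZ.cardY0_not_R1 (p q d : ℕ) (cs : Fin d → TZ) :
    (univ.filter fun s => TZ.Y0 p q d cs s ∧ ¬ TZ.R1 p q d cs s).card = ∏ j, ((cs j).cI + (cs j).cB) := by
  have hpred : ∀ s : (TZ.node p q d cs).St, (TZ.Y0 p q d cs s ∧ ¬ TZ.R1 p q d cs s) ↔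
      ((∀ i, s.1 i = false) ∧ (∀ i, s.2.1 i = false) ∧
        ∀ j, ((s.2.2 j).1 = true → (cs j).adm (s.2.2 j).2 ∧ ¬ (cs j).redK (s.2.2 j).2) ∧
          ((s.2.2 j).1 = false → (cs j).adm (s.2.2 j).2 ∧ ¬ (cs j).rb1 (s.2.2 j).2)) := by
    intro s
    simp only [TZ.Y0, TZ.R1, not_exists, not_and]
    constructor
    · rintro ⟨⟨h1, h2, h⟩, hn⟩
      exact ⟨h1, h2, fun j => ⟨(h j).1, fun he => (TZ.admR_not_rb1 _ _).1 ⟨(h j).2 he, hn j he⟩⟩⟩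
    · rintro ⟨h1, h2, h⟩
      exact ⟨⟨h1, h2, fun j => ⟨(h j).1, fun he => ((TZ.admR_not_rb1 _ _).2 ((h j).2 he)).1⟩⟩,
        fun j he => ((h j).2 he).2⟩
  rw [Finset.filter_congr (fun s _ => hpred s)]
  rw [card_filter_node p q d cs (fun m => ∀ i, m i = false) (fun m => ∀ i, m i = false)
    (fun j x => (x.1 = true → (cs j).adm x.2 ∧ ¬ (cs j).redK x.2) ∧
      (x.1 = false → (cs j).adm x.2 ∧ ¬ (cs j).rb1 x.2))]
  rw [card_allBlue, card_allBlue, one_mul, one_mul]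
  unfold TZ.cI TZ.cB
  exact Finset.prod_congr rfl (fun j _ => card_filter_bool (fun x => (cs j).adm x ∧ ¬ (cs j).redK x)
    (fun x => (cs j).adm x ∧ ¬ (cs j).rb1 x))

/-- The states with no merged child of type 2: `∏ (I_j + A_j)`. -/
theorem TZ.cardY0_not_R2 (p q d : ℕ) (cs : Fin d → TZ) :
    (univ.filter fun s => TZ.Y0 p q d cs s ∧ ¬ TZ.R2 p q d cs s).card = ∏ j, ((cs j).cI + (cs j).cA) := by
  have hpred : ∀ s : (TZ.node p q d cs).St, (TZ.Y0 p q d cs s ∧ ¬ TZ.R2 p q d cs s) ↔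
      ((∀ i, s.1 i = false) ∧ (∀ i, s.2.1 i = false) ∧
        ∀ j, ((s.2.2 j).1 = true → (cs j).adm (s.2.2 j).2 ∧ ¬ (cs j).redK (s.2.2 j).2) ∧
          ((s.2.2 j).1 = false → (cs j).adm (s.2.2 j).2 ∧ ¬ (cs j).rb2 (s.2.2 j).2)) := by
    intro s
    simp only [TZ.Y0, TZ.R2, not_exists, not_and]
    constructor
    · rintro ⟨⟨h1, h2, h⟩, hn⟩
      exact ⟨h1, h2, fun j => ⟨(h j).1, fun he => (TZ.admR_not_rb2 _ _).1 ⟨(h j).2 he, hn j he⟩⟩⟩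
    · rintro ⟨h1, h2, h⟩
      exact ⟨⟨h1, h2, fun j => ⟨(h j).1, fun he => ((TZ.admR_not_rb2 _ _).2 ((h j).2 he)).1⟩⟩,
        fun j he => ((h j).2 he).2⟩
  rw [Finset.filter_congr (fun s _ => hpred s)]
  rw [card_filter_node p q d cs (fun m => ∀ i, m i = false) (fun m => ∀ i, m i = false)
    (fun j x => (x.1 = true → (cs j).adm x.2 ∧ ¬ (cs j).redK x.2) ∧
      (x.1 = false → (cs j).adm x.2 ∧ ¬ (cs j).rb2 x.2))]
  rw [card_allBlue, card_allBlue, one_mul, one_mul]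
  unfold TZ.cI TZ.cA
  exact Finset.prod_congr rfl (fun j _ => card_filter_bool (fun x => (cs j).adm x ∧ ¬ (cs j).redK x)
    (fun x => (cs j).adm x ∧ ¬ (cs j).rb2 x))

/-- The states with no merged child of either type: `∏ (I_j + F_j)`. -/
theorem TZ.cardY0_not_R12 (p q d : ℕ) (cs : Fin d → TZ) :
    (univ.filter fun s => TZ.Y0 p q d cs s ∧ ¬ TZ.R1 p q d cs s ∧ ¬ TZ.R2 p q d cs s).card
      = ∏ j, ((cs j).cI + (cs j).cF) := by
  have hpred : ∀ s : (TZ.node p q d cs).St, (TZ.Y0 p q d cs s ∧ ¬ TZ.R1 p q d cs s ∧ ¬ TZ.R2 p q d cs s) ↔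
      ((∀ i, s.1 i = false) ∧ (∀ i, s.2.1 i = false) ∧
        ∀ j, ((s.2.2 j).1 = true → (cs j).adm (s.2.2 j).2 ∧ ¬ (cs j).redK (s.2.2 j).2) ∧
          ((s.2.2 j).1 = false → (cs j).adm (s.2.2 j).2 ∧ ¬ (cs j).rb1 (s.2.2 j).2 ∧
            ¬ (cs j).rb2 (s.2.2 j).2)) := by
    intro s
    simp only [TZ.Y0, TZ.R1, TZ.R2, not_exists, not_and]
    constructor
    · rintro ⟨⟨h1, h2, h⟩, hn1, hn2⟩
      exact ⟨h1, h2, fun j => ⟨(h j).1, fun he =>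
        ⟨((TZ.admR_not_rb1 _ _).1 ⟨(h j).2 he, hn1 j he⟩).1, hn1 j he, hn2 j he⟩⟩⟩
    · rintro ⟨h1, h2, h⟩
      exact ⟨⟨h1, h2, fun j => ⟨(h j).1, fun he => ((h j).2 he).1.1⟩⟩,
        fun j he => ((h j).2 he).2.1, fun j he => ((h j).2 he).2.2⟩
  rw [Finset.filter_congr (fun s _ => hpred s)]
  rw [card_filter_node p q d cs (fun m => ∀ i, m i = false) (fun m => ∀ i, m i = false)
    (fun j x => (x.1 = true → (cs j).adm x.2 ∧ ¬ (cs j).redK x.2) ∧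
      (x.1 = false → (cs j).adm x.2 ∧ ¬ (cs j).rb1 x.2 ∧ ¬ (cs j).rb2 x.2))]
  rw [card_allBlue, card_allBlue, one_mul, one_mul]
  unfold TZ.cI TZ.cF
  exact Finset.prod_congr rfl (fun j _ => card_filter_bool (fun x => (cs j).adm x ∧ ¬ (cs j).redK x)
    (fun x => (cs j).adm x ∧ ¬ (cs j).rb1 x ∧ ¬ (cs j).rb2 x))

/-- Inclusion–exclusion for two conditions inside a common one. -/
theorem card_filter_incl_excl {α : Type*} [Fintype α] (Y R1 R2 : α → Prop)
    [DecidablePred Y] [DecidablePred R1] [DecidablePred R2] :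
    (univ.filter fun s => Y s ∧ ¬ (R1 s ∧ R2 s)).card + (univ.filter fun s => Y s ∧ ¬ R1 s ∧ ¬ R2 s).card
      = (univ.filter fun s => Y s ∧ ¬ R1 s).card + (univ.filter fun s => Y s ∧ ¬ R2 s).card := by
  classical
  rw [← Finset.card_union_add_card_inter (univ.filter fun s => Y s ∧ ¬ R1 s)
    (univ.filter fun s => Y s ∧ ¬ R2 s)]
  congr 2 <;> ext s <;>
    simp only [Finset.mem_union, Finset.mem_inter, Finset.mem_filter, Finset.mem_univ, true_and] <;> tauto

/-- **The recursion for `I`, unmarked root**: `I + ∏ (I_j + F_j) = ∏ (I_j + B_j) + ∏ (I_j + A_j)`. -/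
theorem TZ.cI_node_zero (p q d : ℕ) (cs : Fin d → TZ) (hp : p = 0) (hq : q = 0) :
    (TZ.node p q d cs).cI + ∏ j, ((cs j).cI + (cs j).cF)
      = ∏ j, ((cs j).cI + (cs j).cB) + ∏ j, ((cs j).cI + (cs j).cA) := by
  have h0 : (TZ.node p q d cs).cI
      = (univ.filter fun s => TZ.Y0 p q d cs s ∧ ¬ (TZ.R1 p q d cs s ∧ TZ.R2 p q d cs s)).card := by
    unfold TZ.cI
    rw [Finset.filter_congr (fun s _ => TZ.predI0_node p q d cs hp hq s)]
  rw [h0, ← TZ.cardY0_not_R12, ← TZ.cardY0_not_R1, ← TZ.cardY0_not_R2]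
  exact card_filter_incl_excl _ _ _

/-- **THE DICTIONARY (C-041.md §15 (c), (i))**: the four cardinalities of the state space of a tree zone are the
four functions of the recursion `TZ.counts`. -/
theorem TZ.counts_eq : ∀ t : TZ, t.counts = ((t.cF : ℝ), (t.cT1 : ℝ), (t.cT2 : ℝ), (t.cI : ℝ))
  | .node p q d cs => by
    have ih : ∀ j, (cs j).counts = (((cs j).cF : ℝ), ((cs j).cT1 : ℝ), ((cs j).cT2 : ℝ), ((cs j).cI : ℝ)) :=
      fun j => TZ.counts_eq (cs j)
    have hg : ∀ j, (cs j).gF = (cs j).cF := fun j => by unfold TZ.gF; rw [ih j]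
    have ht1 : ∀ j, (cs j).t1F = (cs j).cT1 := fun j => by unfold TZ.t1F; rw [ih j]
    have ht2 : ∀ j, (cs j).t2F = (cs j).cT2 := fun j => by unfold TZ.t2F; rw [ih j]
    have hk : ∀ j, (cs j).kF = (cs j).cI := fun j => by unfold TZ.kF; rw [ih j]
    have hN : ∀ j, ((cs j).cN : ℝ) = (cs j).cF + (cs j).cT1 + (cs j).cT2 := fun j => by
      rw [TZ.cN_eq]; push_cast; ring
    have hA : ∀ j, ((cs j).cA : ℝ) = (cs j).cF + (cs j).cT1 := fun j => by rw [TZ.cA_eq]; push_cast; ring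
    have hB : ∀ j, ((cs j).cB : ℝ) = (cs j).cF + (cs j).cT2 := fun j => by rw [TZ.cB_eq]; push_cast; ring
    -- the root's counts
    have e0 : ((TZ.node p q d cs).cF : ℝ) = ∏ j, (2 * ((cs j).cF : ℝ) + (cs j).cT1 + (cs j).cT2) := by
      rw [TZ.cF_node]; push_cast
      exact Finset.prod_congr rfl (fun j _ => by rw [hN]; ring)
    have e1 : ((TZ.node p q d cs).cT1 : ℝ)
        = 2 ^ p * ∏ j, (2 * ((cs j).cF : ℝ) + 2 * (cs j).cT1 + (cs j).cT2)
          - ∏ j, (2 * ((cs j).cF : ℝ) + (cs j).cT1 + (cs j).cT2) := by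
      have h : ((TZ.node p q d cs).cT1 : ℝ) = (TZ.node p q d cs).cA - (TZ.node p q d cs).cF := by
        rw [TZ.cA_eq]; push_cast; ring
      rw [h, e0, TZ.cA_node]; push_cast
      congr 2
      exact Finset.prod_congr rfl (fun j _ => by rw [hN, hA]; ring)
    have e2 : ((TZ.node p q d cs).cT2 : ℝ)
        = 2 ^ q * ∏ j, (2 * ((cs j).cF : ℝ) + (cs j).cT1 + 2 * (cs j).cT2)
          - ∏ j, (2 * ((cs j).cF : ℝ) + (cs j).cT1 + (cs j).cT2) := by
      have h : ((TZ.node p q d cs).cT2 : ℝ) = (TZ.node p q d cs).cB - (TZ.node p q d cs).cF := by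
        rw [TZ.cB_eq]; push_cast; ring
      rw [h, e0, TZ.cB_node]; push_cast
      congr 2
      exact Finset.prod_congr rfl (fun j _ => by rw [hN, hB]; ring)
    have eA : ∏ j, (((cs j).cF : ℝ) + (cs j).cT1 + (cs j).cI) = ∏ j, (((cs j).cI : ℝ) + (cs j).cA) :=
      Finset.prod_congr rfl (fun j _ => by rw [hA]; ring)
    have eB : ∏ j, (((cs j).cF : ℝ) + (cs j).cT2 + (cs j).cI) = ∏ j, (((cs j).cI : ℝ) + (cs j).cB) :=
      Finset.prod_congr rfl (fun j _ => by rw [hB]; ring)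
    have eF : ∏ j, (((cs j).cF : ℝ) + (cs j).cI) = ∏ j, (((cs j).cI : ℝ) + (cs j).cF) :=
      Finset.prod_congr rfl (fun j _ => by ring)
    have e3 : ((TZ.node p q d cs).cI : ℝ)
        = (if q = 0 then ∏ j, (((cs j).cF : ℝ) + (cs j).cT1 + (cs j).cI) else 0)
          + (if p = 0 then ∏ j, (((cs j).cF : ℝ) + (cs j).cT2 + (cs j).cI) else 0)
          - (if p = 0 ∧ q = 0 then ∏ j, (((cs j).cF : ℝ) + (cs j).cI) else 0) := by
      by_cases hp : p = 0 <;> by_cases hq : q = 0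
      · have h' : ((TZ.node p q d cs).cI : ℝ) + ∏ j, (((cs j).cI : ℝ) + (cs j).cF)
            = ∏ j, (((cs j).cI : ℝ) + (cs j).cB) + ∏ j, (((cs j).cI : ℝ) + (cs j).cA) := by
          exact_mod_cast TZ.cI_node_zero p q d cs hp hq
        rw [if_pos hq, if_pos hp, if_pos ⟨hp, hq⟩, eA, eB, eF]
        linarith
      · rw [if_neg hq, if_pos hp, if_neg (fun h => hq h.2), TZ.cI_node_two p q d cs hp
          (Nat.one_le_iff_ne_zero.2 hq), eB]
        push_cast
        ring
      · rw [if_pos hq, if_neg hp, if_neg (fun h => hp h.1), TZ.cI_node_one p q d cs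
          (Nat.one_le_iff_ne_zero.2 hp) hq, eA]
        push_cast
        ring
      · rw [if_neg hq, if_neg hp, if_neg (fun h => hp h.1), TZ.cI_node_both p q d cs
          (Nat.one_le_iff_ne_zero.2 hp) (Nat.one_le_iff_ne_zero.2 hq)]
        push_cast
        ring
    rw [TZ.counts_node]
    simp only [hg, ht1, ht2, hk]
    rw [e0, e1, e2, e3]

/-- The four counts of a tree zone, read through the dictionary. -/
theorem TZ.gF_eq (t : TZ) : t.gF = t.cF := by unfold TZ.gF; rw [TZ.counts_eq]
/-- `t1` through the dictionary. -/
theorem TZ.t1F_eq (t : TZ) : t.t1F = t.cT1 := by unfold TZ.t1F; rw [TZ.counts_eq]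
/-- `t2` through the dictionary. -/
theorem TZ.t2F_eq (t : TZ) : t.t2F = t.cT2 := by unfold TZ.t2F; rw [TZ.counts_eq]
/-- `k` through the dictionary. -/
theorem TZ.kF_eq (t : TZ) : t.kF = t.cI := by unfold TZ.kF; rw [TZ.counts_eq]

/-- **THEOREM (trees) on the state space** (C-041.md §15 (d), §19): the four counts lie in 𝒦. -/
theorem K4_counts (t : TZ) : K4 (t.cF : ℝ) (t.cT1 : ℝ) (t.cT2 : ℝ) (t.cI : ℝ) := by
  have h := tz_K4 t
  rwa [TZ.gF_eq, TZ.t1F_eq, TZ.t2F_eq, TZ.kF_eq] at h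

/-- The invalid states are at most the all-red ones. -/
theorem TZ.cI_le_cF (t : TZ) : t.cI ≤ t.cF := by exact_mod_cast (K4_counts t).k_le_g

/-- **CONJECTURE (CS) on every tree zone with one anchor, as a statement about the counts** (C-041.md §15 (b)):
`(F − I)² ≤ T₁·T₂`. -/
theorem cs_counts (t : TZ) : (t.cF - t.cI) ^ 2 ≤ t.cT1 * t.cT2 := by
  have h := (K4_counts t).cs
  have hle := TZ.cI_le_cF t
  have h2 : (((t.cF - t.cI : ℕ) : ℝ)) ^ 2 ≤ ((t.cT1 * t.cT2 : ℕ) : ℝ) := by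
    rw [Nat.cast_sub hle]; push_cast; exact h
  exact_mod_cast h2

/-- **THE ZONE O-CUBE on every tree zone with one anchor, as a statement about the counts** (C-041.md §14 (a),
§15 (a)): `2·F ≤ T₁ + T₂ + 2·I`, i.e. at least two thirds of the valid states have the anchor's sub-zone
attached to a terminal. -/
theorem zoneOCube_counts (t : TZ) : 2 * t.cF ≤ t.cT1 + t.cT2 + 2 * t.cI := by
  have h := zoneOCube_nonneg_of_K4 (K4_counts t)
  exact_mod_cast (by linarith : (2 * t.cF : ℝ) ≤ t.cT1 + t.cT2 + 2 * t.cI)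

end TreeClosure

end PercRepro
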